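import Literature.NumberTheory.LFunctions.PrimeNumberTheoremProgressions
import Mathlib.Analysis.SpecialFunctions.Pow.Asymptotics
import Mathlib.Analysis.PSeries
import HarnessLib

/-!
# Prime sums `∑_{p ≡ a (Q), p > y} p^{-σ}` near `σ = 1`: the budgets of the greedy steering

Topic `Literature/NumberTheory/LFunctions` (namespace `Literature.NumberTheory.LFunctions`).
Everything in this file is PROVED; there are no definitions and no named facts.

Saias–Weingartner (*Zeros of Dirichlet series with periodic coefficients*, Acta Arith. 140
(2009), proof of Lemma 1): "Using the prime number theorem for arithmetic progressions, we
readily find that there exists an `η > 0`, such that for each `1 < σ ≤ 1 + η` and `1 ≤ a ≤ q`,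
`(a, q) = 1`, we have `S_a ≥ 10 ‖C⁻¹‖_∞ R`", `S_a = ∑_{p > y, p ≡ a (q)} p^{-σ}`. This file
supplies that input, in the form consumed by the greedy steering lemma
`Literature.NumberTheory.LFunctions.SWSteering.exists_phases_hasSum`
(`SaiasWeingartnerSteering.lean`), from the tree's prime number theorem for arithmetic
progressions `Literature.NumberTheory.LFunctions.sum_log_prime_residue_isLittleO`
(`θ(X; q, a) = X/φ(q) + o(X)`):

* `SWBudget.exists_block_lower` — dyadic blocks: for `X ≥ X₀(q, a)` and `σ ≥ 0`,
  `∑_{X < p ≤ 2X, p ≡ a} p^{-σ} ≥ X (2X)^{-σ} / (4 φ(q) log (2X))`;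
* `SWBudget.exists_large_step` — for all large primes `p` (in every reduced class) and all
  `σ ∈ [0, 3/2]`, `p^{-σ} + C/p ≤ ∑_{p < p' ≤ 2p, p' ≡ p} p'^{-σ}`;
* `SWBudget.exists_eta_tail_ge` — for every `Y` and `B` there is `η > 0` with
  `∑_{Y < p ≤ N, p ≡ a} p^{-σ} ≥ B` for a suitable `N`, all `1 ≤ σ ≤ 1 + η` and all reduced `a`;
* `SWBudget.exists_eta_budget` — the two budget conditions of `exists_phases_hasSum` for the
  radii `r k = k^{-σ}` on the primes `k > y` (classes = reduced residues mod `Q ≤ y`) and the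
  drift bounds `δ k = C / k²`, uniformly for `1 < σ ≤ 1 + η`.

## References

* [SaiasWeingartner2009] E. Saias, A. Weingartner, Acta Arith. 140 (2009), 335–344, §3,
  proof of Lemma 1.
* [MontgomeryVaughan2007] H. L. Montgomery, R. C. Vaughan, *Multiplicative Number Theory I*,
  Cor. 11.17 (the prime number theorem for arithmetic progressions used).
-/

noncomputable section

open Filter Finset Asymptotics Real
open scoped Topology

namespace Literature.NumberTheory.LFunctions

namespace SWBudget

/-! ### Dyadic blocks of primes in a progression -/

/-- `θ(2X; q, a) - θ(X; q, a)` is the sum of `log p` over the primes `X < p ≤ 2X` of the class.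
[folklore] -/
theorem sum_Icc_two_mul_sub_sum_Icc {q : ℕ} (a : ZMod q) (X : ℕ) (f : ℕ → ℝ) :
    ∑ p ∈ Icc 1 (2 * X) with p.Prime ∧ ((p : ℕ) : ZMod q) = a, f p -
      ∑ p ∈ Icc 1 X with p.Prime ∧ ((p : ℕ) : ZMod q) = a, f p =
      ∑ p ∈ Ioc X (2 * X) with p.Prime ∧ ((p : ℕ) : ZMod q) = a, f p := by
  have hunion : Icc 1 (2 * X) = Icc 1 X ∪ Ioc X (2 * X) := by
    ext p
    simp only [mem_Icc, mem_union, mem_Ioc]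
    omega
  have hdisj : Disjoint (Icc 1 X) (Ioc X (2 * X)) := by
    rw [disjoint_left]
    intro p hp hp'
    rw [mem_Icc] at hp
    rw [mem_Ioc] at hp'
    omega
  rw [hunion, filter_union, sum_union (disjoint_filter_filter hdisj)]
  ring

/-- **Dyadic blocks of a progression carry their share** (from the prime number theorem for
arithmetic progressions, `θ(X; q, a) = X/φ(q) + o(X)`): for `X ≥ X₀(q, a)`,
`∑_{X < p ≤ 2X, p ≡ a (q)} log p ≥ X / (4 φ(q))`.
[cite: MontgomeryVaughan2007, Cor. 11.17 (main term)] -/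
theorem exists_block_log_lower {q : ℕ} [NeZero q] {a : ZMod q} (ha : IsUnit a) :
    ∃ X₀ : ℕ, ∀ X : ℕ, X₀ ≤ X →
      (X : ℝ) / (4 * q.totient) ≤
        ∑ p ∈ Ioc X (2 * X) with p.Prime ∧ ((p : ℕ) : ZMod q) = a, Real.log p := by
  have hφ : (0 : ℝ) < q.totient := by exact_mod_cast Nat.totient_pos.2 (NeZero.pos q)
  have h := (sum_log_prime_residue_isLittleO ha).def (c := (4 * (q.totient : ℝ))⁻¹)
    (by positivity)
  rw [eventually_atTop] at h
  obtain ⟨X₁, hX₁⟩ := h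
  refine ⟨X₁, fun X hX ↦ ?_⟩
  have h1 := hX₁ X hX
  have h2 := hX₁ (2 * X) (by omega)
  rw [Real.norm_eq_abs, Real.norm_of_nonneg (Nat.cast_nonneg _)] at h1 h2
  rw [← sum_Icc_two_mul_sub_sum_Icc a X]
  have h1' := (abs_le.1 h1).2
  have h2' := (abs_le.1 h2).1
  push_cast at h2'  h1' ⊢
  have hq : (q.totient : ℝ)⁻¹ * (2 * (X : ℝ)) - (4 * (q.totient : ℝ))⁻¹ * (2 * X)
      - ((q.totient : ℝ)⁻¹ * X + (4 * (q.totient : ℝ))⁻¹ * X) = (X : ℝ) / (4 * q.totient) := by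
    field_simp
    ring
  linarith

/-- **Dyadic block lower bound for `∑ p^{-σ}`**: for `X ≥ X₀(q, a)`, `X ≥ 1` and `σ ≥ 0`,
`X (2X)^{-σ} / (4 φ(q) log (2X)) ≤ ∑_{X < p ≤ 2X, p ≡ a (q)} p^{-σ}`
(each `log p ≤ log 2X` and each `p^{-σ} ≥ (2X)^{-σ}`).
[cite: SaiasWeingartner2009, §3 (proof of Lemma 1, "using the prime number theorem for
arithmetic progressions")] -/
theorem exists_block_lower {q : ℕ} [NeZero q] {a : ZMod q} (ha : IsUnit a) :
    ∃ X₀ : ℕ, 1 ≤ X₀ ∧ ∀ X : ℕ, X₀ ≤ X → ∀ σ : ℝ, 0 ≤ σ →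
      (X : ℝ) * (2 * X : ℝ) ^ (-σ) / (4 * q.totient * Real.log (2 * X)) ≤
        ∑ p ∈ Ioc X (2 * X) with p.Prime ∧ ((p : ℕ) : ZMod q) = a, (p : ℝ) ^ (-σ) := by
  obtain ⟨X₀, hX₀⟩ := exists_block_log_lower ha
  have hφ : (0 : ℝ) < q.totient := by exact_mod_cast Nat.totient_pos.2 (NeZero.pos q)
  refine ⟨max X₀ 1, le_max_right _ _, fun X hX σ hσ ↦ ?_⟩
  have hX1 : 1 ≤ X := le_of_max_le_right hX
  have hXr : (1 : ℝ) ≤ X := by exact_mod_cast hX1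
  have hlog : 0 < Real.log (2 * X) := Real.log_pos (by linarith)
  have h2X : (0 : ℝ) < 2 * X := by linarith
  have hblock := hX₀ X (le_of_max_le_left hX)
  set S := (Ioc X (2 * X)).filter (fun p ↦ p.Prime ∧ ((p : ℕ) : ZMod q) = a) with hS
  -- termwise comparison
  have hterm : ∀ p ∈ S, (2 * X : ℝ) ^ (-σ) / Real.log (2 * X) * Real.log p ≤ (p : ℝ) ^ (-σ) := by
    intro p hp
    rw [hS, mem_filter, mem_Ioc] at hp
    have hp0 : (0 : ℝ) < p := by exact_mod_cast hp.2.1.pos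
    have hp2X : (p : ℝ) ≤ 2 * X := by exact_mod_cast hp.1.2
    have hlogp : Real.log p ≤ Real.log (2 * X) := Real.log_le_log hp0 hp2X
    have hlogp0 : 0 ≤ Real.log p := Real.log_nonneg (by exact_mod_cast hp.2.1.one_lt.le)
    have hpow : (2 * X : ℝ) ^ (-σ) ≤ (p : ℝ) ^ (-σ) :=
      Real.rpow_le_rpow_of_nonpos hp0 hp2X (by linarith)
    have hpow0 : 0 ≤ (2 * X : ℝ) ^ (-σ) := Real.rpow_nonneg h2X.le _
    calc (2 * X : ℝ) ^ (-σ) / Real.log (2 * X) * Real.log p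
        = (2 * X : ℝ) ^ (-σ) * (Real.log p / Real.log (2 * X)) := by ring
      _ ≤ (p : ℝ) ^ (-σ) * 1 := by
          refine mul_le_mul hpow ((div_le_one hlog).2 hlogp) (by positivity) ?_
          exact Real.rpow_nonneg hp0.le _
      _ = (p : ℝ) ^ (-σ) := mul_one _
  have hsum := Finset.sum_le_sum hterm
  rw [← Finset.mul_sum] at hsum
  have hpos : 0 ≤ (2 * X : ℝ) ^ (-σ) / Real.log (2 * X) := by positivity
  calc (X : ℝ) * (2 * X : ℝ) ^ (-σ) / (4 * q.totient * Real.log (2 * X))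
      = (2 * X : ℝ) ^ (-σ) / Real.log (2 * X) * ((X : ℝ) / (4 * q.totient)) := by
        field_simp
    _ ≤ (2 * X : ℝ) ^ (-σ) / Real.log (2 * X) *
        ∑ p ∈ S, Real.log p := mul_le_mul_of_nonneg_left hblock hpos
    _ ≤ ∑ p ∈ S, (p : ℝ) ^ (-σ) := hsum


/-- `exists_block_lower` uniformly over the reduced classes (finitely many). [folklore] -/
theorem exists_block_lower_uniform (q : ℕ) [NeZero q] :
    ∃ X₀ : ℕ, 1 ≤ X₀ ∧ ∀ a : (ZMod q)ˣ, ∀ X : ℕ, X₀ ≤ X → ∀ σ : ℝ, 0 ≤ σ →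
      (X : ℝ) * (2 * X : ℝ) ^ (-σ) / (4 * q.totient * Real.log (2 * X)) ≤
        ∑ p ∈ Ioc X (2 * X) with p.Prime ∧ ((p : ℕ) : ZMod q) = a, (p : ℝ) ^ (-σ) := by
  classical
  choose X₀ hX₀ using fun a : (ZMod q)ˣ ↦ exists_block_lower (q := q) (a := (a : ZMod q))
    a.isUnit
  refine ⟨max 1 (univ.sup X₀), le_max_left _ _, fun a X hX σ hσ ↦ ?_⟩
  exact (hX₀ a).2 X ((Finset.le_sup (mem_univ a)).trans (le_of_max_le_right hX)) σ hσ

/-- `log p · p^{1/2} ≤ ε p` for all large `p`. [folklore] -/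
theorem eventually_log_mul_sqrt_le {ε : ℝ} (hε : 0 < ε) :
    ∃ P₀ : ℕ, ∀ p : ℕ, P₀ ≤ p → Real.log p * (p : ℝ) ^ (1 / 2 : ℝ) ≤ ε * p := by
  have h1 : (fun x : ℝ ↦ Real.log x * x ^ (1 / 2 : ℝ)) =o[atTop]
      fun x : ℝ ↦ x ^ (1 / 2 : ℝ) * x ^ (1 / 2 : ℝ) :=
    (isLittleO_log_rpow_atTop (by norm_num : (0 : ℝ) < 1 / 2)).mul_isBigO (isBigO_refl _ _)
  have h2 := (h1.comp_tendsto tendsto_natCast_atTop_atTop).def hε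
  rw [eventually_atTop] at h2
  obtain ⟨P₀, hP₀⟩ := h2
  refine ⟨max P₀ 1, fun p hp ↦ ?_⟩
  have h := hP₀ p (le_of_max_le_left hp)
  have hp0 : (0 : ℝ) ≤ p := Nat.cast_nonneg _
  simp only [Function.comp_apply] at h
  rw [← Real.rpow_add_of_nonneg hp0 (by norm_num) (by norm_num),
    show (1 / 2 : ℝ) + 1 / 2 = 1 by norm_num, Real.rpow_one, Real.norm_of_nonneg hp0,
    Real.norm_of_nonneg] at h
  · exact h
  · exact mul_nonneg (Real.log_nonneg (by exact_mod_cast le_of_max_le_right hp))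
      (Real.rpow_nonneg hp0 _)

/-- **Large primes: one dyadic block already pays for the step.** For every `C ≥ 0` there is
`P₀` such that for all primes `p ≥ P₀` and all `0 ≤ σ ≤ 3/2`,
`p^{-σ} + C/p ≤ ∑_{p < p' ≤ 2p, p' ≡ p (q)} p'^{-σ}`. [folklore] -/
theorem exists_large_step (q : ℕ) [NeZero q] {C : ℝ} (hC : 0 ≤ C) :
    ∃ P₀ : ℕ, q < P₀ ∧ ∀ p : ℕ, P₀ ≤ p → p.Prime → ∀ σ : ℝ, 0 ≤ σ → σ ≤ 3 / 2 →
      (p : ℝ) ^ (-σ) + C / p ≤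
        ∑ p' ∈ Ioc p (2 * p) with p'.Prime ∧ ((p' : ℕ) : ZMod q) = (p : ZMod q),
          (p' : ℝ) ^ (-σ) := by
  obtain ⟨X₀, hX₀1, hX₀⟩ := exists_block_lower_uniform q
  have hφ : (0 : ℝ) < q.totient := by exact_mod_cast Nat.totient_pos.2 (NeZero.pos q)
  set ε : ℝ := (32 * q.totient * (1 + C))⁻¹ with hε
  have hεpos : 0 < ε := by positivity
  obtain ⟨P₁, hP₁⟩ := eventually_log_mul_sqrt_le hεpos
  refine ⟨max (max X₀ P₁) (q + 2), by omega, fun p hp hprime σ hσ0 hσ ↦ ?_⟩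
  have hpX₀ : X₀ ≤ p := le_trans (le_max_left _ _) (le_of_max_le_left hp)
  have hpP₁ : P₁ ≤ p := le_trans (le_max_right _ _) (le_of_max_le_left hp)
  have hpq : q < p := by omega
  have hp2 : 2 ≤ p := by omega
  have hp2r : (2 : ℝ) ≤ p := by exact_mod_cast hp2
  have hp1r : (1 : ℝ) ≤ p := by linarith
  have hp0r : (0 : ℝ) < p := by linarith
  -- the class of `p` is a unit
  have hcop : p.Coprime q := (Nat.Prime.coprime_iff_not_dvd hprime).2
      (fun hdvd ↦ absurd (Nat.le_of_dvd (NeZero.pos q) hdvd) (by omega))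
  have hunit : IsUnit (p : ZMod q) := (ZMod.isUnit_iff_coprime p q).2 hcop
  have hblock := hX₀ hunit.unit p hpX₀ σ hσ0
  rw [IsUnit.unit_spec] at hblock
  refine le_trans ?_ hblock
  -- elementary inequalities
  have hlog2p : Real.log (2 * p) ≤ 2 * Real.log p := by
    rw [Real.log_mul two_ne_zero hp0r.ne', two_mul]
    linarith [Real.log_le_log two_pos hp2r]
  have hlogp : 0 < Real.log p := Real.log_pos (by linarith)
  have hlog2p0 : 0 < Real.log (2 * p) := Real.log_pos (by linarith)
  have hmain := hP₁ p hpP₁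
  -- `(2p)^{-σ} ≥ p^{-σ} / 4`
  have h2σ : (1 : ℝ) / 4 ≤ (2 : ℝ) ^ (-σ) := by
    have : (2 : ℝ) ^ (-(2 : ℝ)) ≤ 2 ^ (-σ) :=
      Real.rpow_le_rpow_of_exponent_le one_le_two (by linarith)
    have h4 : (2 : ℝ) ^ (-(2 : ℝ)) = 1 / 4 := by
      rw [Real.rpow_neg zero_le_two, show (2 : ℝ) = (2 : ℕ) by norm_num, Real.rpow_natCast]
      norm_num
    rw [← h4]
    exact this
  have hppow : 0 < (p : ℝ) ^ (-σ) := Real.rpow_pos_of_pos hp0r _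
  have h2p : (2 * p : ℝ) ^ (-σ) = (2 : ℝ) ^ (-σ) * (p : ℝ) ^ (-σ) :=
    Real.mul_rpow zero_le_two hp0r.le
  -- `C / p ≤ C p^{1/2} p^{-σ}`
  have hsqrt1 : (1 : ℝ) ≤ (p : ℝ) ^ (1 / 2 : ℝ) := Real.one_le_rpow hp1r (by norm_num)
  have hCp : C / p ≤ C * (p : ℝ) ^ (1 / 2 : ℝ) * (p : ℝ) ^ (-σ) := by
    have h1 : (p : ℝ) ^ (-(3 / 2 : ℝ)) ≤ (p : ℝ) ^ (-σ) :=
      Real.rpow_le_rpow_of_exponent_le hp1r (by linarith)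
    have h2 : (p : ℝ)⁻¹ = (p : ℝ) ^ (1 / 2 : ℝ) * (p : ℝ) ^ (-(3 / 2 : ℝ)) := by
      rw [← Real.rpow_add hp0r, ← Real.rpow_neg_one]
      norm_num
    rw [div_eq_mul_inv, h2, ← mul_assoc]
    exact mul_le_mul_of_nonneg_left h1 (by positivity)
  -- assemble: `p^{-σ} (1 + C √p) ≤ p (2p)^{-σ} / (4 φ log 2p)`
  have hkey : (1 + C * (p : ℝ) ^ (1 / 2 : ℝ)) * (16 * q.totient * Real.log (2 * p)) ≤ p := by
    calc (1 + C * (p : ℝ) ^ (1 / 2 : ℝ)) * (16 * q.totient * Real.log (2 * p))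
        ≤ ((1 + C) * (p : ℝ) ^ (1 / 2 : ℝ)) * (16 * q.totient * (2 * Real.log p)) := by
          gcongr
          · nlinarith
      _ = 32 * q.totient * (1 + C) * (Real.log p * (p : ℝ) ^ (1 / 2 : ℝ)) := by ring
      _ ≤ 32 * q.totient * (1 + C) * (ε * p) := by gcongr
      _ = p := by rw [hε]; field_simp
  have hden : 0 < 4 * (q.totient : ℝ) * Real.log (2 * p) := by positivity
  rw [le_div_iff₀ hden, h2p]
  calc ((p : ℝ) ^ (-σ) + C / p) * (4 * q.totient * Real.log (2 * p))
      ≤ ((p : ℝ) ^ (-σ) + C * (p : ℝ) ^ (1 / 2 : ℝ) * (p : ℝ) ^ (-σ))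
          * (4 * q.totient * Real.log (2 * p)) := by gcongr
    _ = (p : ℝ) ^ (-σ) * (1 / 4) *
          ((1 + C * (p : ℝ) ^ (1 / 2 : ℝ)) * (16 * q.totient * Real.log (2 * p))) := by ring
    _ ≤ (p : ℝ) ^ (-σ) * (2 : ℝ) ^ (-σ) * p := by gcongr
    _ = p * ((2 : ℝ) ^ (-σ) * (p : ℝ) ^ (-σ)) := by ring


/-! ### Divergence near `σ = 1` -/

/-- Splitting `∑_{Y < p ≤ 2X} = ∑_{Y < p ≤ X} + ∑_{X < p ≤ 2X}` for `Y ≤ X`. [folklore] -/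
theorem sum_Ioc_two_mul_eq_add {q : ℕ} (a : ZMod q) {Y X : ℕ} (hYX : Y ≤ X) (f : ℕ → ℝ) :
    ∑ p ∈ Ioc Y (2 * X) with p.Prime ∧ ((p : ℕ) : ZMod q) = a, f p =
      ∑ p ∈ Ioc Y X with p.Prime ∧ ((p : ℕ) : ZMod q) = a, f p +
      ∑ p ∈ Ioc X (2 * X) with p.Prime ∧ ((p : ℕ) : ZMod q) = a, f p := by
  have hunion : Ioc Y (2 * X) = Ioc Y X ∪ Ioc X (2 * X) := by
    ext p
    simp only [mem_union, mem_Ioc]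
    omega
  have hdisj : Disjoint (Ioc Y X) (Ioc X (2 * X)) := by
    rw [disjoint_left]
    intro p hp hp'
    rw [mem_Ioc] at hp hp'
    omega
  rw [hunion, filter_union, sum_union (disjoint_filter_filter hdisj)]

/-- The dyadic block estimate at `X = 2^j` for `σ` close to `1`: if `σ ≤ 1 + 1/M` and
`j + 1 ≤ M` then `2^j (2^{j+1})^{-σ} / (4 φ log 2^{j+1}) ≥ 1 / (32 φ (j+1))`. [folklore] -/
theorem block_const_lower {φ : ℝ} (hφ : 0 < φ) {M j : ℕ} (hjM : j + 1 ≤ M) {σ : ℝ}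
    (hσ : σ ≤ 1 + 1 / M) :
    1 / (32 * φ * (j + 1)) ≤
      ((2 ^ j : ℕ) : ℝ) * (2 * ((2 ^ j : ℕ) : ℝ)) ^ (-σ) / (4 * φ * Real.log (2 * ((2 ^ j : ℕ) : ℝ))) := by
  have hM : (0 : ℝ) < M := by exact_mod_cast (show 0 < M by omega)
  have hjM' : (j : ℝ) + 1 ≤ M := by exact_mod_cast hjM
  -- `2 * 2^j = 2^(j+1)` and logs
  have h2j : (2 : ℝ) * ((2 ^ j : ℕ) : ℝ) = (2 : ℝ) ^ ((j : ℝ) + 1) := by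
    rw [Nat.cast_pow, Nat.cast_ofNat, Real.rpow_add two_pos, Real.rpow_natCast, Real.rpow_one]
    ring
  have hlog : Real.log (2 * ((2 ^ j : ℕ) : ℝ)) = ((j : ℝ) + 1) * Real.log 2 := by
    rw [h2j, Real.log_rpow two_pos]
  have hlog2 : Real.log 2 ≤ 1 := by
    have := Real.log_le_sub_one_of_pos two_pos
    linarith
  have hlog2pos : 0 < Real.log 2 := Real.log_pos one_lt_two
  have hlogpos : 0 < ((j : ℝ) + 1) * Real.log 2 := by positivity
  -- the power: `2^j (2^{j+1})^{-σ} = 2^{j - (j+1)σ} ≥ 2^{-3} = 1/8`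
  have hpow : (1 : ℝ) / 8 ≤ ((2 ^ j : ℕ) : ℝ) * (2 * ((2 ^ j : ℕ) : ℝ)) ^ (-σ) := by
    have h1 : ((2 ^ j : ℕ) : ℝ) * (2 * ((2 ^ j : ℕ) : ℝ)) ^ (-σ) =
        (2 : ℝ) ^ ((j : ℝ) + ((j : ℝ) + 1) * (-σ)) := by
      rw [h2j, ← Real.rpow_mul zero_le_two, Nat.cast_pow, Nat.cast_ofNat, ← Real.rpow_natCast,
        ← Real.rpow_add two_pos]
    have h2 : (-3 : ℝ) ≤ (j : ℝ) + ((j : ℝ) + 1) * (-σ) := by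
      have hj0 : (0 : ℝ) ≤ j := Nat.cast_nonneg _
      have : ((j : ℝ) + 1) * σ ≤ ((j : ℝ) + 1) * (1 + 1 / M) :=
        mul_le_mul_of_nonneg_left hσ (by positivity)
      have h3 : ((j : ℝ) + 1) * (1 / M) ≤ 1 := by
        rw [mul_one_div, div_le_one hM]; exact hjM'
      nlinarith
    have h3 : (2 : ℝ) ^ (-3 : ℝ) = 1 / 8 := by
      rw [Real.rpow_neg zero_le_two, show (3 : ℝ) = (3 : ℕ) by norm_num, Real.rpow_natCast]
      norm_num
    rw [h1, ← h3]
    exact Real.rpow_le_rpow_of_exponent_le one_le_two h2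
  rw [hlog, div_le_div_iff₀ (by positivity) (by positivity)]
  calc 1 * (4 * φ * ((↑j + 1) * Real.log 2)) = (4 * φ * (j + 1)) * Real.log 2 := by ring
    _ ≤ (4 * φ * (j + 1)) * 1 := mul_le_mul_of_nonneg_left hlog2 (by positivity)
    _ = (1 / 8) * (32 * φ * (j + 1)) := by ring
    _ ≤ ((2 ^ j : ℕ) : ℝ) * (2 * ((2 ^ j : ℕ) : ℝ)) ^ (-σ) * (32 * φ * (j + 1)) :=
        mul_le_mul_of_nonneg_right hpow (by positivity)

/-- **The prime sums `∑_{p ≡ a} p^{-σ}` are large near `σ = 1`, uniformly in the class**: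
for every `Y` and `B` there are `η > 0` and `N` with
`B ≤ ∑_{Y < p ≤ N, p ≡ a (q)} p^{-σ}` for all `1 ≤ σ ≤ 1 + η` and all reduced classes `a`
(dyadic blocks and the divergence of the harmonic series).
[cite: SaiasWeingartner2009, §3 (proof of Lemma 1)] -/
theorem exists_eta_tail_ge (q : ℕ) [NeZero q] (Y : ℕ) (B : ℝ) :
    ∃ η : ℝ, 0 < η ∧ ∃ N : ℕ, ∀ a : (ZMod q)ˣ, ∀ σ : ℝ, 1 ≤ σ → σ ≤ 1 + η →
      B ≤ ∑ p ∈ Ioc Y N with p.Prime ∧ ((p : ℕ) : ZMod q) = a, (p : ℝ) ^ (-σ) := by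
  obtain ⟨X₀, hX₀1, hX₀⟩ := exists_block_lower_uniform q
  have hφ : (0 : ℝ) < q.totient := by exact_mod_cast Nat.totient_pos.2 (NeZero.pos q)
  set φ : ℝ := (q.totient : ℝ) with hφdef
  -- starting exponent `J₀` with `Y, X₀ ≤ 2^{J₀}`
  set J₀ : ℕ := Y + X₀ with hJ₀
  have hJ₀Y : Y ≤ 2 ^ J₀ := le_trans (by omega) (Nat.lt_two_pow_self).le
  have hJ₀X : X₀ ≤ 2 ^ J₀ := le_trans (by omega) (Nat.lt_two_pow_self).le
  -- harmonic divergence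
  have hharm := Real.tendsto_sum_range_one_div_nat_succ_atTop
  rw [tendsto_atTop] at hharm
  have hev := hharm (32 * φ * B + ∑ i ∈ range J₀, (1 : ℝ) / (i + 1))
  rw [eventually_atTop] at hev
  obtain ⟨M₁, hM₁⟩ := hev
  set M : ℕ := max M₁ (J₀ + 1) with hMdef
  have hJ₀M : J₀ + 1 ≤ M := le_max_right _ _
  have hMpos : (0 : ℝ) < M := by exact_mod_cast (show 0 < M by omega)
  refine ⟨1 / M, by positivity, 2 ^ M, fun a σ hσ1 hσ ↦ ?_⟩
  -- induction over the blocks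
  have key : ∀ m : ℕ, J₀ + m ≤ M →
      (1 / (32 * φ)) * ∑ i ∈ range m, (1 : ℝ) / ((J₀ + i : ℕ) + 1) ≤
        ∑ p ∈ Ioc Y (2 ^ (J₀ + m)) with p.Prime ∧ ((p : ℕ) : ZMod q) = a, (p : ℝ) ^ (-σ) := by
    intro m
    induction m with
    | zero =>
      intro _
      simp only [sum_range_zero, mul_zero]
      exact sum_nonneg fun p _ ↦ Real.rpow_nonneg (Nat.cast_nonneg _) _
    | succ m ih =>
      intro hm
      have ih' := ih (by omega)
      have hpow : 2 ^ (J₀ + (m + 1)) = 2 * 2 ^ (J₀ + m) := by rw [← add_assoc, pow_succ]; ring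
      rw [hpow, sum_Ioc_two_mul_eq_add (a : ZMod q) (le_trans hJ₀Y (Nat.pow_le_pow_right
        two_pos (by omega))), sum_range_succ, mul_add]
      refine add_le_add ih' ?_
      have hblock := hX₀ a (2 ^ (J₀ + m)) (le_trans hJ₀X (Nat.pow_le_pow_right two_pos
        (by omega))) σ (by linarith)
      refine le_trans ?_ (le_trans (block_const_lower hφ (show J₀ + m + 1 ≤ M by omega) hσ)
        ?_)
      · rw [Nat.cast_add]
        apply le_of_eq
        field_simp
      · exact_mod_cast hblock
  have hfin := key (M - J₀) (by omega)
  have hMJ : J₀ + (M - J₀) = M := by omega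
  rw [hMJ] at hfin
  refine le_trans ?_ hfin
  -- the harmonic block sum is large
  have hrange : ∑ i ∈ range (M - J₀), (1 : ℝ) / ((J₀ + i : ℕ) + 1) =
      ∑ i ∈ range M, (1 : ℝ) / (i + 1) - ∑ i ∈ range J₀, (1 : ℝ) / (i + 1) := by
    rw [← sum_Ico_eq_sub _ (by omega : J₀ ≤ M), sum_Ico_eq_sum_range]
  have hM₁M := hM₁ M (le_max_left _ _)
  rw [hrange, mul_sub, le_sub_iff_add_le]
  have h32 : (0 : ℝ) < 1 / (32 * φ) := by positivity
  calc B + 1 / (32 * φ) * ∑ i ∈ range J₀, (1 : ℝ) / (i + 1)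
      = 1 / (32 * φ) * (32 * φ * B + ∑ i ∈ range J₀, (1 : ℝ) / (i + 1)) := by
        field_simp
    _ ≤ 1 / (32 * φ) * ∑ i ∈ range M, (1 : ℝ) / (i + 1) :=
        mul_le_mul_of_nonneg_left hM₁M h32.le


/-! ### Packaging for the greedy steering lemma -/

/-- Tail of `∑ C/n²`: `∑_{m ≥ 0} C/(m+k)² ≤ 2C/k` for `k ≥ 2`. [folklore] -/
theorem tsum_div_sq_add_le {C : ℝ} (hC : 0 ≤ C) {k : ℕ} (hk : 2 ≤ k) :
    ∑' m : ℕ, C / ((m + k : ℕ) : ℝ) ^ 2 ≤ 2 * C / k := by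
  have hk' : (2 : ℝ) ≤ k := by exact_mod_cast hk
  have hbound : ∀ n, ∑ i ∈ range n, C / ((i + k : ℕ) : ℝ) ^ 2 ≤ C / ((k : ℝ) - 1) := by
    intro n
    have hterm : ∀ i ∈ range n, C / ((i + k : ℕ) : ℝ) ^ 2 ≤
        C / ((i : ℝ) + k - 1) - C / ((i + 1 : ℕ) + k - 1) := by
      intro i _
      have hi : (0 : ℝ) ≤ i := Nat.cast_nonneg _
      push_cast
      have h1 : (1 : ℝ) ≤ (i : ℝ) + k - 1 := by linarith
      have hne1 : (i : ℝ) + k - 1 ≠ 0 := by linarith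
      have hne2 : (i : ℝ) + k ≠ 0 := by linarith
      have h2 : C / ((i : ℝ) + k - 1) - C / ((i : ℝ) + 1 + k - 1) =
          C / (((i : ℝ) + k - 1) * ((i : ℝ) + k)) := by
        rw [show (i : ℝ) + 1 + k - 1 = (i : ℝ) + k by ring, div_sub_div _ _ hne1 hne2]
        congr 1
        ring
      rw [h2]
      apply div_le_div_of_nonneg_left hC (by positivity)
      nlinarith
    refine (sum_le_sum hterm).trans ?_
    rw [Finset.sum_range_sub' (fun i : ℕ ↦ C / ((i : ℝ) + k - 1)) n]
    simp only [Nat.cast_zero, zero_add]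
    have : 0 ≤ C / ((n : ℝ) + k - 1) := by
      apply div_nonneg hC
      have : (0 : ℝ) ≤ n := Nat.cast_nonneg _
      linarith
    linarith
  refine (Real.tsum_le_of_sum_range_le (fun n ↦ by positivity) hbound).trans ?_
  rw [div_le_div_iff₀ (by linarith) (by positivity)]
  nlinarith

/-- `∑_{n} C/n² ≤ 2C` (the term `n = 0` is `C/0 = 0`). [folklore] -/
theorem tsum_div_sq_le {C : ℝ} (hC : 0 ≤ C) : ∑' n : ℕ, C / (n : ℝ) ^ 2 ≤ 2 * C := by
  have hs : Summable fun n : ℕ ↦ C / (n : ℝ) ^ 2 :=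
    ((Real.summable_one_div_nat_pow.mpr one_lt_two).mul_left C).congr fun n ↦ mul_one_div C _
  have h0 : ∑' n : ℕ, C / (n : ℝ) ^ 2 =
      C / ((0 : ℕ) : ℝ) ^ 2 + ∑' n : ℕ, C / ((n + 1 : ℕ) : ℝ) ^ 2 := hs.tsum_eq_zero_add
  have hs1 : Summable fun n : ℕ ↦ C / ((n + 1 : ℕ) : ℝ) ^ 2 := (summable_nat_add_iff 1).2 hs
  have h1 : ∑' n : ℕ, C / ((n + 1 : ℕ) : ℝ) ^ 2 =
      C / ((0 + 1 : ℕ) : ℝ) ^ 2 + ∑' n : ℕ, C / ((n + 1 + 1 : ℕ) : ℝ) ^ 2 :=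
    hs1.tsum_eq_zero_add
  have h2 : ∑' m : ℕ, C / ((m + 2 : ℕ) : ℝ) ^ 2 ≤ 2 * C / (2 : ℕ) :=
    tsum_div_sq_add_le hC le_rfl
  have h3 : ∑' n : ℕ, C / ((n + 1 + 1 : ℕ) : ℝ) ^ 2 = ∑' m : ℕ, C / ((m + 2 : ℕ) : ℝ) ^ 2 :=
    tsum_congr fun m ↦ rfl
  have h4 : (2 : ℝ) * C / ((2 : ℕ) : ℝ) = C := by push_cast; ring
  rw [h4] at h2
  rw [h0, h1, h3]
  have h5 : C / ((0 : ℕ) : ℝ) ^ 2 = 0 := by simp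
  have h6 : C / ((0 + 1 : ℕ) : ℝ) ^ 2 = C := by simp
  rw [h5, h6]
  linarith

/-- A finite set of indices beyond `k` contributes at most the tail `∑_{m} g (m + (k+1))` of a
non-negative summable sequence. [folklore] -/
theorem sum_le_tsum_nat_add {g : ℕ → ℝ} (hg : ∀ n, 0 ≤ g n) (hgs : Summable g) {k : ℕ}
    {S : Finset ℕ} (hS : ∀ p ∈ S, k < p) :
    ∑ p ∈ S, g p ≤ ∑' m : ℕ, g (m + (k + 1)) := by
  have h1 := hgs.sum_add_tsum_nat_add (k + 1)
  have hdisj : Disjoint S (range (k + 1)) := by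
    rw [disjoint_left]
    intro p hp hp'
    have := hS p hp
    rw [mem_range] at hp'
    omega
  have h2 : ∑ p ∈ S ∪ range (k + 1), g p ≤ ∑' n, g n :=
    hgs.sum_le_tsum _ fun n _ ↦ hg n
  rw [sum_union hdisj] at h2
  linarith

/-- The class-restricted prime sums are summable for `σ > 1`. [folklore] -/
theorem summable_indicator_rpow {P : ℕ → Prop} [DecidablePred P] {σ : ℝ} (hσ : 1 < σ) :
    Summable fun n : ℕ ↦ if P n then (n : ℝ) ^ (-σ) else 0 := by
  refine (Real.summable_nat_rpow.2 (by linarith : -σ < -1)).of_nonneg_of_le (fun n ↦ ?_)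
    fun n ↦ ?_
  · split_ifs
    · exact Real.rpow_nonneg (Nat.cast_nonneg _) _
    · exact le_rfl
  · split_ifs
    · exact le_rfl
    · exact Real.rpow_nonneg (Nat.cast_nonneg _) _

/-- **The budgets of the greedy steering** (the input "by the prime number theorem for
arithmetic progressions … `S_a ≥ 10 ‖C⁻¹‖_∞ R`" of [SaiasWeingartner2009], proof of Lemma 1, in
the form needed by `SWSteering.exists_phases_hasSum`): radii `r k = k^{-σ}` on the primes
`k > y`, classes `u k` (the reduced residue of `k` mod `q` for primes `k > y`), drift bounds
`δ k = C/k²`. There is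
`η ∈ (0, 1/2]` such that for all `1 < σ ≤ 1 + η`: every class has budget at least `W + ∑ δ`, and
for every active `k`, `r k + ∑_{m ≥ k} δ m` is at most the budget of the class of `k` beyond `k`.
[cite: SaiasWeingartner2009, §3 (proof of Lemma 1)] -/
theorem exists_eta_budget {q : ℕ} [NeZero q] {y : ℕ} (u : ℕ → (ZMod q)ˣ)
    (hu : ∀ k, k.Prime → y < k → ((u k : ZMod q) = (k : ZMod q))) {W C : ℝ} (hW : 0 ≤ W)
    (hC : 0 ≤ C) :
    ∃ η : ℝ, 0 < η ∧ η ≤ 1 / 2 ∧ ∀ σ : ℝ, 1 < σ → σ ≤ 1 + η →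
      (∀ a : (ZMod q)ˣ, W + ∑' k : ℕ, C / (k : ℝ) ^ 2 ≤
        ∑' k : ℕ, if u k = a then (if k.Prime ∧ y < k then (k : ℝ) ^ (-σ) else 0) else 0) ∧
      (∀ k : ℕ, 0 < (if k.Prime ∧ y < k then (k : ℝ) ^ (-σ) else 0) →
        (if k.Prime ∧ y < k then (k : ℝ) ^ (-σ) else 0) + ∑' m : ℕ, C / ((m + k : ℕ) : ℝ) ^ 2 ≤
          ∑' m : ℕ, if u (m + (k + 1)) = u k then
            (if (m + (k + 1)).Prime ∧ y < m + (k + 1) then ((m + (k + 1) : ℕ) : ℝ) ^ (-σ)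
              else 0) else 0) := by
  classical
  obtain ⟨P₀, hqP₀, hP₀⟩ := exists_large_step q (C := 2 * C) (by positivity)
  set P : ℕ := max P₀ (y + 1) with hPdef
  set B : ℝ := W + 2 * C + 1 + C with hBdef
  obtain ⟨η₁, hη₁, N, hN⟩ := exists_eta_tail_ge q P B
  refine ⟨min (1 / 2) η₁, lt_min (by norm_num) hη₁, min_le_left _ _, fun σ hσ1 hσ ↦ ?_⟩
  have hσ32 : σ ≤ 3 / 2 := by linarith [min_le_left (1 / 2 : ℝ) η₁]
  have hση₁ : σ ≤ 1 + η₁ := by linarith [min_le_right (1 / 2 : ℝ) η₁]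
  -- the summand of class `a`
  have hg0 : ∀ (a : (ZMod q)ˣ) (n : ℕ), 0 ≤ (if u n = a then
      (if n.Prime ∧ y < n then (n : ℝ) ^ (-σ) else 0) else 0) := by
    intro a n
    split_ifs
    · exact Real.rpow_nonneg (Nat.cast_nonneg _) _
    · exact le_rfl
    · exact le_rfl
  have hgs : ∀ a : (ZMod q)ˣ, Summable fun n : ℕ ↦ (if u n = a then
      (if n.Prime ∧ y < n then (n : ℝ) ^ (-σ) else 0) else 0) := by
    intro a
    have := summable_indicator_rpow (P := fun n ↦ u n = a ∧ (n.Prime ∧ y < n)) hσ1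
    refine this.congr fun n ↦ ?_
    by_cases h : u n = a <;> simp [h]
  -- on the relevant finite sets the summand is `p^{-σ}`
  have hgeq : ∀ (a : (ZMod q)ˣ) (S : Finset ℕ), (∀ p ∈ S, p.Prime ∧ y < p ∧ ((p : ℕ) : ZMod q) = a) →
      ∑ p ∈ S, (p : ℝ) ^ (-σ) =
        ∑ p ∈ S, (if u p = a then (if p.Prime ∧ y < p then (p : ℝ) ^ (-σ) else 0) else 0) := by
    intro a S hS
    refine sum_congr rfl fun p hp ↦ ?_
    obtain ⟨hp1, hp2, hp3⟩ := hS p hp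
    have hua : u p = a := Units.ext (by rw [hu p hp1 hp2, hp3])
    rw [if_pos hua, if_pos ⟨hp1, hp2⟩]
  have htot := tsum_div_sq_le hC
  constructor
  · -- total budget of each class
    intro a
    have htail := hN a σ hσ1.le hση₁
    have hmem : ∀ p ∈ (Ioc P N).filter (fun p ↦ p.Prime ∧ ((p : ℕ) : ZMod q) = a),
        p.Prime ∧ y < p ∧ ((p : ℕ) : ZMod q) = a := by
      intro p hp
      rw [mem_filter, mem_Ioc] at hp
      exact ⟨hp.2.1, by omega, hp.2.2⟩
    rw [hgeq a _ hmem] at htail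
    have hle := (hgs a).sum_le_tsum ((Ioc P N).filter (fun p ↦ p.Prime ∧ ((p : ℕ) : ZMod q) = a))
      (fun n _ ↦ hg0 a n)
    linarith
  · -- the step condition
    intro k hk
    have hkP : k.Prime ∧ y < k := by
      by_contra h
      rw [if_neg h] at hk
      exact lt_irrefl _ hk
    rw [if_pos hkP]
    have hk2 : 2 ≤ k := hkP.1.two_le
    have hkr : (2 : ℝ) ≤ k := by exact_mod_cast hk2
    have hΔ := tsum_div_sq_add_le hC hk2
    have hclass : ((k : ℕ) : ZMod q) = (u k : ZMod q) := (hu k hkP.1 hkP.2).symm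
    rcases le_or_gt P₀ k with hkP₀ | hkP₀
    · -- large `k`: one dyadic block suffices
      have hstep := hP₀ k hkP₀ hkP.1 σ (by linarith) hσ32
      have hmem : ∀ p ∈ (Ioc k (2 * k)).filter
          (fun p ↦ p.Prime ∧ ((p : ℕ) : ZMod q) = (k : ZMod q)),
          p.Prime ∧ y < p ∧ ((p : ℕ) : ZMod q) = (u k : ZMod q) := by
        intro p hp
        rw [mem_filter, mem_Ioc] at hp
        exact ⟨hp.2.1, by omega, hp.2.2.trans hclass⟩
      rw [hgeq (u k) _ hmem] at hstep
      have hle := sum_le_tsum_nat_add (hg0 (u k)) (hgs (u k)) (k := k)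
        (S := (Ioc k (2 * k)).filter (fun p ↦ p.Prime ∧ ((p : ℕ) : ZMod q) = (k : ZMod q)))
        (fun p hp ↦ by rw [mem_filter, mem_Ioc] at hp; exact hp.1.1)
      have h2C : ∑' m : ℕ, C / ((m + k : ℕ) : ℝ) ^ 2 ≤ 2 * C / k := hΔ
      linarith
    · -- small `k`: the whole tail beyond `P` is at least `B ≥ 1 + C`
      have htail := hN (u k) σ hσ1.le hση₁
      have hmem : ∀ p ∈ (Ioc P N).filter (fun p ↦ p.Prime ∧ ((p : ℕ) : ZMod q) = (u k : ZMod q)),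
          p.Prime ∧ y < p ∧ ((p : ℕ) : ZMod q) = (u k : ZMod q) := by
        intro p hp
        rw [mem_filter, mem_Ioc] at hp
        exact ⟨hp.2.1, by omega, hp.2.2⟩
      rw [hgeq (u k) _ hmem] at htail
      have hle := sum_le_tsum_nat_add (hg0 (u k)) (hgs (u k)) (k := k)
        (S := (Ioc P N).filter (fun p ↦ p.Prime ∧ ((p : ℕ) : ZMod q) = (u k : ZMod q)))
        (fun p hp ↦ by rw [mem_filter, mem_Ioc] at hp; omega)
      have hr1 : (k : ℝ) ^ (-σ) ≤ 1 :=
        Real.rpow_le_one_of_one_le_of_nonpos (by linarith) (by linarith)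
      have hΔC : ∑' m : ℕ, C / ((m + k : ℕ) : ℝ) ^ 2 ≤ C := by
        refine hΔ.trans ?_
        rw [div_le_iff₀ (by linarith)]
        nlinarith
      have hB : 1 + C ≤ B := by rw [hBdef]; linarith
      linarith

end SWBudget

end Literature.NumberTheory.LFunctions
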